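import Literature.RingTheory.CompleteLocalRings.CoefficientFieldSquareZero
import Mathlib.RingTheory.Derivation.ToSquareZero
import Mathlib.RingTheory.Ideal.Cotangent
import Mathlib.RingTheory.LocalRing.ResidueField.Basic
import Mathlib.Algebra.TrivSqZeroExt.Basic
import Mathlib.Algebra.MvPolynomial.Basic
import HarnessLib

/-!
# Derivations for the Jacobian criteria (Matsumura §30): cotangent functionals, moving coefficients

Topic: `Literature/AlgebraicGeometry/Resolution`. Two supplies of derivations used in the proof
that the weak Jacobian condition (WJ) holds in polynomial rings over a field
(`WeakJacobianPolynomial.lean`, discharging `Matsumura1987_30_WJ_polynomial`):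

1. `exists_derivation_apply_eq` — **every linear functional on `𝔪/𝔪²` comes from a
   derivation.** For a local ring `R` containing a field, with maximal ideal `𝔪` and residue
   field `κ`, every `κ`-linear `φ : 𝔪/𝔪² → κ` is `m ↦ D(m)` for a derivation `D : R → κ`. In
   Matsumura this is the injectivity of `𝔪/𝔪² → Ω_R ⊗_R κ` (Thm. 25.2) for `κ` `0`-smooth over
   the prime field (Thm. 26.9, used in the proofs of Thms. 30.3 and 30.5); we obtain it instead
   from I. S. Cohen's coefficient field of the square-zero thickening `R/𝔪²`
   (`Literature.RingTheory.CompleteLocalRings.exists_ringHom_section_of_sq_eq_bot`): a ring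
   section `σ` of `R/𝔪² → κ` gives the derivation `x ↦ σ(x̄) - x` of `R` into `𝔪/𝔪²`
   (Mathlib's `derivationToSquareZeroOfLift`), which is `-id` on `𝔪`.
2. `MvPolynomial.exists_derivation_C_eq_X_eq` — **derivations of `k[X_σ]` with moving
   coefficients**: a derivation `δ` of the coefficient ring `k` into a `k[X_σ]`-algebra `T`
   extends to a derivation of `k[X_σ]` with prescribed values on the variables (through the
   ring homomorphism `k[X_σ] → T[ε]`, `c ↦ c + δ(c)ε`, `X_i ↦ X_i + v_i ε`); Matsumura's
   derivations `D_γ ∈ Der(S)` attached to a `p`-basis of `k` (Thm. 30.5 (2)) are instances.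
   `MvPolynomial.derivation_apply_eq_of_eqOn` — two derivations of `k[X_σ]` agreeing on the
   coefficients of `f` and on the variables agree on `f`.

Derivations are taken over `ℤ` (`Der(A) = Der_ℤ(A)`, Matsumura §25 p. 190), except in the
last two lemmas, which hold over any base. In (1) the derivation is returned as a bare additive
map satisfying the Leibniz rule, so that users with concrete `R` (localisations carry several
`ℤ`-algebra structures) can repackage it.

## Sources

* H. Matsumura, *Commutative Ring Theory*, CUP 1986: Thm. 25.2 p. 194 [PDF 212]; §28 Thm. 28.3
  p. 215 [232]; §30 Thms. 30.3, 30.5 pp. 231–235 [249–253]. [Matsumura1987]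
-/

noncomputable section

open IsLocalRing MvPolynomial

namespace Literature.AlgebraicGeometry.Resolution

universe u v w

/-! ## 1. Derivations of a local ring into its residue field -/

section CotangentFunctionals

variable {R : Type u} [CommRing R] [IsLocalRing R]

/-- **Every linear functional on `𝔪/𝔪²` comes from a derivation.** Let `R` be a local ring
containing a field `k`, with maximal ideal `𝔪` and residue field `κ`. For every `κ`-linear map
`φ : 𝔪/𝔪² → κ` there is a derivation `D : R → κ` (an additive map satisfying the Leibniz rule;
we return the bare function to stay clear of the several `ℤ`-algebra structures a concrete
`R` may carry) with `D(m) = φ(m̄)` for `m ∈ 𝔪`.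
Proof: by Cohen's theorem (`exists_ringHom_section_of_sq_eq_bot`) the projection
`R/𝔪² → κ` has a ring section `σ`; `x ↦ σ(x̄) - x` is a derivation `R → 𝔪/𝔪² ⊆ R/𝔪²`
(Mathlib's `derivationToSquareZeroOfLift`) equal to `-id` on `𝔪`, and we compose with `-φ`.
This replaces, for our purposes, the injectivity of `𝔪/𝔪² → Ω_R ⊗ κ` of Matsumura Thm. 25.2
for `κ` `0`-smooth over the prime field. [cite: Matsumura1987, Thm. 25.2 with Thm. 28.3 (ii)] -/
theorem exists_derivation_apply_eq (k : Type*) [Field k] [Algebra k R]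
    (φ : CotangentSpace R →ₗ[ResidueField R] ResidueField R) :
    ∃ D : R → ResidueField R, (∀ a b, D (a + b) = D a + D b) ∧
      (∀ a b, D (a * b) = a • D b + b • D a) ∧
      ∀ m : maximalIdeal R, D (m : R) = φ ((maximalIdeal R).toCotangent m) := by
  set M := maximalIdeal R with hM
  set J : Ideal (R ⧸ M ^ 2) := M.cotangentIdeal with hJ
  have hJ2 : J ^ 2 = ⊥ := M.cotangentIdeal_square
  have hJmap : J = M.map (Ideal.Quotient.mk (M ^ 2)) :=
    (Ideal.map_eq_submodule_map (Ideal.Quotient.mk (M ^ 2)) M).symm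
  haveI hJmax : J.IsMaximal := by
    rcases Ideal.map_eq_top_or_isMaximal_of_surjective (Ideal.Quotient.mk (M ^ 2))
      Ideal.Quotient.mk_surjective (IsLocalRing.maximalIdeal.isMaximal R) with h | h
    · exfalso
      have h1 : J.comap (Ideal.Quotient.mk (M ^ 2)) = ⊤ := by rw [hJmap, h, Ideal.comap_top]
      rw [hJ, Ideal.comap_cotangentIdeal] at h1
      exact (IsLocalRing.maximalIdeal.isMaximal R).ne_top h1
    · rwa [hJmap]
  obtain ⟨σ, hσ⟩ :=
    Literature.RingTheory.CompleteLocalRings.exists_ringHom_section_of_sq_eq_bot k J hJ2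
  -- the twisted lift `x ↦ σ(x mod J)` of `R → (R/𝔪²)/J`
  set f : R →ₐ[ℤ] R ⧸ M ^ 2 :=
    (σ.comp ((Ideal.Quotient.mk J).comp (Ideal.Quotient.mk (M ^ 2)))).toIntAlgHom with hf
  have hfapply : ∀ x, f x = σ (Ideal.Quotient.mk J (Ideal.Quotient.mk (M ^ 2) x)) := fun x => rfl
  have he : (Ideal.Quotient.mkₐ ℤ J).comp f = IsScalarTower.toAlgHom ℤ R ((R ⧸ M ^ 2) ⧸ J) := by
    ext x
    rw [AlgHom.comp_apply, Ideal.Quotient.mkₐ_eq_mk, hfapply, hσ]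
    rfl
  set D₀ := derivationToSquareZeroOfLift J hJ2 f he with hD₀
  have hD₀m : ∀ m : M, (D₀ (m : R) : R ⧸ M ^ 2) = -(Ideal.Quotient.mk (M ^ 2) (m : R)) := by
    intro m
    rw [hD₀, derivationToSquareZeroOfLift_apply, hfapply]
    have h0 : Ideal.Quotient.mk J (Ideal.Quotient.mk (M ^ 2) (m : R)) = 0 :=
      Ideal.Quotient.eq_zero_iff_mem.mpr (Ideal.mk_mem_cotangentIdeal.mpr m.2)
    rw [h0, map_zero, zero_sub]
    rfl
  -- compose with `-φ ∘ (𝔪/𝔪² ≅ J)⁻¹`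
  set g : J →ₗ[R] ResidueField R :=
    (φ.restrictScalars R) ∘ₗ M.cotangentEquivIdeal.symm.toLinearMap with hg
  set Dn : Derivation ℤ R (ResidueField R) := -(LinearMap.compDer g D₀) with hDn
  refine ⟨Dn, map_add Dn, Dn.leibniz, fun m => ?_⟩
  have hval : D₀ (m : R) =
      -⟨Ideal.Quotient.mk (M ^ 2) (m : R), Ideal.mk_mem_cotangentIdeal.mpr m.2⟩ :=
    Subtype.ext (by rw [hD₀m]; rfl)
  calc Dn (m : R) = -(g (D₀ (m : R))) := rfl
    _ = φ (M.cotangentEquivIdeal.symm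
          ⟨Ideal.Quotient.mk (M ^ 2) (m : R), Ideal.mk_mem_cotangentIdeal.mpr m.2⟩) := by
        rw [hval, map_neg, neg_neg]
        rfl
    _ = φ (M.toCotangent m) := by
        congr 1
        exact M.cotangentEquivIdeal_symm_apply (m : R) m.2

end CotangentFunctionals

/-! ## 2. Derivations of polynomial rings with moving coefficients -/

section Coeff

variable {k : Type u} [CommRing k] {σ : Type v} {T : Type w} [CommRing T] [Algebra k T]
  [Algebra (MvPolynomial σ k) T] [IsScalarTower k (MvPolynomial σ k) T]

/-- **Derivations of `k[X_σ]` with moving coefficients.** For a derivation `δ : k → T` of the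
coefficient ring into a `k[X_σ]`-algebra `T` and values `v_i ∈ T`, there is a derivation `D` of
`k[X_σ]` into `T` (over `ℤ`) extending `δ` with `D(X_i) = v_i`. Construction: the second
component of the ring homomorphism `k[X_σ] → T[ε] = T ⊕ Tε`, `c ↦ c + δ(c)ε`,
`X_i ↦ X_i + v_i ε`, whose first component is the structure map (Matsumura §30, p. 234: the
derivations `D_γ ∈ Der(S)` with `D_γ(u_γ') = δ_γγ'`, `D_γ(X_i) = 0` attached to a `p`-basis
`{u_γ}` of `k` are instances). [cite: Matsumura1987, Thm. 30.5 (2)] -/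
theorem MvPolynomial.exists_derivation_C_eq_X_eq (δ : Derivation ℤ k T) (v : σ → T) :
    ∃ D : Derivation ℤ (MvPolynomial σ k) T, (∀ c, D (C c) = δ c) ∧ ∀ i, D (X i) = v i := by
  -- the ring homomorphism `k → T[ε]`, `c ↦ c + δ(c) ε`
  let g₀ : k →+* TrivSqZeroExt T T :=
    { toFun := fun c => TrivSqZeroExt.inl (algebraMap k T c) + TrivSqZeroExt.inr (δ c)
      map_one' := by
        rw [map_one, Derivation.map_one_eq_zero, TrivSqZeroExt.inr_zero, add_zero]; rfl
      map_mul' := fun a b => by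
        refine TrivSqZeroExt.ext ?_ ?_
        · simp
        · simp only [TrivSqZeroExt.snd_add, TrivSqZeroExt.snd_inl, TrivSqZeroExt.snd_inr,
            zero_add, TrivSqZeroExt.snd_mul, TrivSqZeroExt.fst_add, TrivSqZeroExt.fst_inl,
            TrivSqZeroExt.fst_inr, add_zero, Derivation.leibniz, smul_eq_mul,
            MulOpposite.smul_eq_mul_unop, MulOpposite.unop_op, Algebra.smul_def, map_mul]
          ring
      map_zero' := by
        rw [map_zero, map_zero, TrivSqZeroExt.inl_zero, TrivSqZeroExt.inr_zero, add_zero]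
      map_add' := fun a b => by
        refine TrivSqZeroExt.ext ?_ ?_ <;> simp [add_add_add_comm] }
  have hg₀ : ∀ c, g₀ c = TrivSqZeroExt.inl (algebraMap k T c) + TrivSqZeroExt.inr (δ c) :=
    fun c => rfl
  -- its extension `g : k[X_σ] → T[ε]`, `X_i ↦ X_i + v_i ε`
  let g : MvPolynomial σ k →+* TrivSqZeroExt T T := eval₂Hom g₀ fun i =>
    TrivSqZeroExt.inl (algebraMap (MvPolynomial σ k) T (X i)) + TrivSqZeroExt.inr (v i)
  have hgC : ∀ c, g (C c) = g₀ c := fun c => eval₂Hom_C _ _ c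
  have hgX : ∀ i, g (X i) =
      TrivSqZeroExt.inl (algebraMap (MvPolynomial σ k) T (X i)) + TrivSqZeroExt.inr (v i) :=
    fun i => eval₂Hom_X' _ _ i
  -- the first component of `g` is the structure map
  have hfst : ∀ f, (g f).fst = algebraMap (MvPolynomial σ k) T f := by
    intro f
    induction f using MvPolynomial.induction_on with
    | C c =>
      rw [hgC, hg₀, TrivSqZeroExt.fst_add, TrivSqZeroExt.fst_inl, TrivSqZeroExt.fst_inr,
        add_zero, IsScalarTower.algebraMap_apply k (MvPolynomial σ k) T,
        MvPolynomial.algebraMap_eq]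
    | add f f' hf hf' => rw [map_add, TrivSqZeroExt.fst_add, hf, hf', map_add]
    | mul_X f i hf =>
      rw [map_mul, TrivSqZeroExt.fst_mul, hf, hgX, TrivSqZeroExt.fst_add,
        TrivSqZeroExt.fst_inl, TrivSqZeroExt.fst_inr, add_zero, map_mul]
  -- so the second component is a derivation
  let D : Derivation ℤ (MvPolynomial σ k) T :=
    Derivation.mk'
      (AddMonoidHom.toIntLinearMap
        { toFun := fun s => (g s).snd
          map_zero' := by rw [map_zero, TrivSqZeroExt.snd_zero]
          map_add' := fun a b => by rw [map_add, TrivSqZeroExt.snd_add] })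
      fun a b => by
        change (g (a * b)).snd = a • (g b).snd + b • (g a).snd
        rw [map_mul, TrivSqZeroExt.snd_mul, hfst, hfst, smul_eq_mul, op_smul_eq_mul,
          Algebra.smul_def, Algebra.smul_def, mul_comm ((g a).snd)]
  have hD : ∀ s, D s = (g s).snd := fun s => rfl
  refine ⟨D, fun c => ?_, fun i => ?_⟩
  · rw [hD, hgC, hg₀, TrivSqZeroExt.snd_add, TrivSqZeroExt.snd_inl, TrivSqZeroExt.snd_inr,
      zero_add]
  · rw [hD, hgX, TrivSqZeroExt.snd_add, TrivSqZeroExt.snd_inl, TrivSqZeroExt.snd_inr, zero_add]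

end Coeff

section EqOn

variable {R₀ : Type*} [CommRing R₀] {k : Type u} [CommRing k] [Algebra R₀ k] {σ : Type v}
  {N : Type w} [AddCommGroup N] [Module (MvPolynomial σ k) N] [Module R₀ N]

/-- A derivation of `k[X_σ]` vanishing on all variables vanishes on all monic monomials.
[folklore] -/
theorem MvPolynomial.derivation_monomial_one_eq_zero (Δ : Derivation R₀ (MvPolynomial σ k) N)
    (hX : ∀ i, Δ (X i) = 0) (s : σ →₀ ℕ) : Δ (monomial s (1 : k)) = 0 := by
  classical
  rw [monomial_eq, C_1, one_mul, Finsupp.prod]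
  induction s.support using Finset.induction_on with
  | empty => rw [Finset.prod_empty, Derivation.map_one_eq_zero]
  | insert a t hat ih =>
    rw [Finset.prod_insert hat, Derivation.leibniz, ih, Derivation.leibniz_pow, hX]
    simp only [smul_zero, zero_add]

/-- **Two derivations of `k[X_σ]` which agree on the coefficients of `f` and on the variables
agree on `f`.** [folklore] -/
theorem MvPolynomial.derivation_apply_eq_of_eqOn (D D' : Derivation R₀ (MvPolynomial σ k) N)
    (f : MvPolynomial σ k) (hC : ∀ c ∈ f.coeffs, D (C c) = D' (C c))
    (hX : ∀ i, D (X i) = D' (X i)) : D f = D' f := by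
  rw [← sub_eq_zero, ← Derivation.sub_apply]
  set Δ := D - D' with hΔ
  have hΔX : ∀ i, Δ (X i) = 0 := fun i => by rw [hΔ, Derivation.sub_apply, hX, sub_self]
  have hΔC : ∀ c ∈ f.coeffs, Δ (C c) = 0 := fun c hc => by
    rw [hΔ, Derivation.sub_apply, hC c hc, sub_self]
  conv_lhs => rw [f.as_sum]
  rw [map_sum]
  refine Finset.sum_eq_zero fun v hv => ?_
  have hmono : monomial v (coeff v f) = C (coeff v f) * monomial v 1 := by
    rw [C_mul_monomial, mul_one]
  rw [hmono, Derivation.leibniz, MvPolynomial.derivation_monomial_one_eq_zero Δ hΔX, smul_zero,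
    zero_add, hΔC _ (coeff_mem_coeffs v (mem_support_iff.mp hv)), smul_zero]

end EqOn


end Literature.AlgebraicGeometry.Resolution

end
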